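import Summits.ResolutionOfSingularities.ResolutionOfSingularities.Theorems.FrobeniusLadderFInjectiveMacaulayficationProp44SigmaCurves
import Summits.ResolutionOfSingularities.ResolutionOfSingularities.Theorems.FrobeniusLadderFInjectiveMacaulayficationProp44PointStepCurves
import Literature.AlgebraicGeometry.Resolution.StrictTransformTransverseCurveLocal
import Literature.AlgebraicGeometry.Resolution.EmbeddedCurveConfigurationPointBlowups
import Literature.AlgebraicGeometry.Resolution.BlowupsExistence
import HarnessLib

/-!
# [CoP1] Prop. 4.4, steps 1–2 — point blowing-ups until the curves of `Σ` are regular and transverse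

[AI: prover `res-inputs-p-5a` (cell res-hironaka; F-71 census row L2 = skeleton v5.2 `stub_reachTidy`, Phase I of the REACH
decomposition, design note `plan/inputs/p-5a/L2-REACH-TIDY-DESIGN-p5a-v0.md`). Not a statement of the manuscript under adjudication.
AI-written; AI review is weaker than expert review.]

**Phase I of the algorithm of Cossart–Piltant 2008, Prop. 4.4** («1- If `Σ(i)` has an irreducible component of dimension one which is
singular, let `X(i+1)` be the blowing up along any such singular point. 2- If `Σ(i)` has regular components of dimension one which do not
intersect transversally, let `X(i+1)` be the blowing up along any such non-transverse intersection point»): starting from an integral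
Noetherian regular quasi-excellent `X` of dimension `≤ 3` with `(J, μ)` (`ord ≤ μ`, `codim V(J) ≥ 2`), a finite sequence of permissible
blowing-ups at closed points reaches a stage at which every one-dimensional component of `Σ = {ord ≥ μ}` is regular and any two of them
meet transversally (`exists_seq_regular_transverse`). PROOF: otherwise there is an infinite run of blowing-ups at bad points
(`exists_chain_of_forall_step`, a dependent choice along `IsPermissibleBlowupSeq`), which the termination brick
`false_of_badPointChain_of_curveConfiguration` (embedded resolution of the configuration of curves, res-inputs-p-9a) forbids — its rule
for the successor configuration is Lemma 4.3 read through `CP2008Prop44.pointStep_curves'` (ρ1′: a new curve is a regular line,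
two new lines are equal or disjoint) and the pointwise transversality of strict transforms to the exceptional divisor
(`exists_isRsopPart_strictTransform_of_transverseAt`): `pointStep_next`.
[cite: CossartPiltant2008, Prop. 4.4 (proof, p. 10, steps 1–2)]
-/

-- `Summit.<Summit>.<Sub>.Theorems` with `Sub = Summit` (single-conjunct summit, D-0017)
set_option linter.dupNamespace false

noncomputable section

open CategoryTheory CategoryTheory.Limits AlgebraicGeometry TopologicalSpace IsLocalRing
open Literature.AlgebraicGeometry.Resolution Scheme.IdealSheafData

namespace Summit.ResolutionOfSingularities.ResolutionOfSingularities.Theorems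

namespace CP2008Prop44

universe u

/-! ## §1 Infinite runs by dependent choice -/

/-- **Dependent choice along `IsPermissibleBlowupSeq`.** If every stage reachable from `(X, J, μ)` by a W4.6 sequence of permissible
blowing-ups admits one more permissible blowing up (regular centre inside `{ord ≥ μ}`) with a property `P`, then there is an infinite
run of such blowing-ups, every step of which has `P`. [folklore] -/
theorem exists_chain_of_forall_step {X : Scheme.{u}} (J : X.IdealSheafData) {μ : ℕ}
    (P : ∀ (X₁ : Scheme.{u}), X₁.IdealSheafData → Closeds X₁ → Prop)
    (H : ∀ (X₁ : Scheme.{u}) (Φ : X₁ ⟶ X) (J₁ : X₁.IdealSheafData), CampaignW46.IsPermissibleBlowupSeq J μ Φ J₁ →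
      ∃ (X₂ : Scheme.{u}) (π : X₂ ⟶ X₁) (D : Closeds X₁),
        IsBlowup π (vanishingIdeal D) ∧ Scheme.IsRegular (vanishingIdeal D).subscheme ∧
        (∀ y ∈ (D : Set X₁), (μ : ℕ∞) ≤ idealOrder J₁ y) ∧ P X₁ J₁ D) :
    ∃ (Xs : ℕ → Scheme.{u}) (π : ∀ n, Xs (n + 1) ⟶ Xs n) (D : ∀ n, Closeds (Xs n))
      (Js : ∀ n, (Xs n).IdealSheafData) (Φ : ∀ n, Xs n ⟶ X),
      (∀ n, IsBlowup (π n) (vanishingIdeal (D n))) ∧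
      (∀ n, CampaignW46.IsPermissibleBlowupSeq J μ (Φ n) (Js n)) ∧
      (∀ n, Js (n + 1) = controlledTransform (π n) (vanishingIdeal (D n)) (Js n) μ) ∧
      (∀ n, ∀ y ∈ (D n : Set (Xs n)), (μ : ℕ∞) ≤ idealOrder (Js n) y) ∧
      (∀ n, P (Xs n) (Js n) (D n)) := by
  choose Xn πn Dn hbl hreg hord hP using H
  let S : Type (u + 1) := Σ' (X₁ : Scheme.{u}) (Φ : X₁ ⟶ X) (J₁ : X₁.IdealSheafData),
    CampaignW46.IsPermissibleBlowupSeq J μ Φ J₁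
  let next : S → S := fun s =>
    ⟨Xn s.1 s.2.1 s.2.2.1 s.2.2.2, πn s.1 s.2.1 s.2.2.1 s.2.2.2 ≫ s.2.1,
      controlledTransform (πn s.1 s.2.1 s.2.2.1 s.2.2.2) (vanishingIdeal (Dn s.1 s.2.1 s.2.2.1 s.2.2.2)) s.2.2.1 μ,
      CampaignW46.IsPermissibleBlowupSeq.blowup s.2.2.2 _ _ (hreg _ _ _ _) (hord _ _ _ _) (hbl _ _ _ _)⟩
  let s₀ : S := ⟨X, 𝟙 X, J, CampaignW46.IsPermissibleBlowupSeq.nil⟩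
  let ch : ℕ → S := fun n => Nat.rec s₀ (fun _ s => next s) n
  exact ⟨fun n => (ch n).1, fun n => πn (ch n).1 (ch n).2.1 (ch n).2.2.1 (ch n).2.2.2,
    fun n => Dn (ch n).1 (ch n).2.1 (ch n).2.2.1 (ch n).2.2.2,
    fun n => (ch n).2.2.1, fun n => (ch n).2.1, fun n => hbl _ _ _ _, fun n => (ch n).2.2.2, fun n => rfl,
    fun n => hord _ _ _ _, fun n => hP _ _ _ _⟩

/-! ## §2 One blowing up at a closed point: the successor configuration of curves -/

/-- Off the centre a blowing up is a bijection, so a non-closed point off the exceptional divisor maps to a non-closed point. [folklore] -/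
theorem not_isClosed_singleton_apply {X X' : Scheme.{u}} {π : X' ⟶ X} {I : X.IdealSheafData} (hπ : IsBlowup π I)
    {η' : X'} (hη' : ¬ IsClosed ({η'} : Set X')) (hsupp : π η' ∉ (I.support : Set X)) :
    ¬ IsClosed ({π η'} : Set X) := by
  intro hcl
  have heq : π ⁻¹' {π η'} = {η'} := by
    ext q
    simp only [Set.mem_preimage, Set.mem_singleton_iff]
    exact ⟨fun hq => (hπ.existsUnique_preimage_of_not_mem_support hsupp).unique hq rfl, fun hq => by rw [hq]⟩
  exact hη' (heq ▸ hcl.preimage π.continuous)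

/-- The stalk of the vanishing ideal sheaf of a closed set at one of its points is a proper ideal. [folklore] -/
theorem stalkIdeal_vanishingIdeal_le_maximalIdeal {X : Scheme.{u}} (Z : Closeds X) {q : X} (hq : q ∈ (Z : Set X)) :
    stalkIdeal (vanishingIdeal Z) q ≤ maximalIdeal (X.presheaf.stalk q) := by
  refine (mem_support_iff_stalkIdeal_le _ _).mp ?_
  rw [← SetLike.mem_coe, Scheme.IdealSheafData.coe_support_vanishingIdeal]
  exact hq

/-- **The successor rule of the configuration of curves under one blowing up at a closed point** (the hypothesis `hnext` of
`false_of_badPointChain_of_curveConfiguration` for the curves of `Σ`): after blowing up a closed point `x` of order `μ` of the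
regular threefold `X`, every curve of `Σ′` (closure of a non-closed maximal point of `{ord ≥ μ}` upstairs) is either the strict
transform of a curve of `Σ`, or regular and transverse at every common point to every other curve of `Σ′` except possibly the strict
transforms of the curves of `Σ` singular at `x`. From Lemma 4.3 via `pointStep_curves'`: a curve over `x` is a regular line, two such
are equal or disjoint, and the strict transform of a curve regular at `x` is transverse to the exceptional divisor, which contains the
line. [cite: CossartPiltant2008, Lemma 4.3 (1) (3) (5); Prop. 4.4 (proof, p. 10, steps 1–2)] -/
theorem pointStep_next {X X' : Scheme.{u}} [IsLocallyNoetherian X] [IsLocallyNoetherian X'] (hX : Scheme.IsRegular X)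
    (hX3 : topologicalKrullDim X ≤ 3) (J : X.IdealSheafData) {μ : ℕ} (hμ : 1 ≤ μ) (hle : ∀ z, idealOrder J z ≤ μ)
    (hcodim : ∀ z ∈ J.support, 1 < Order.coheight z) {x : X} (hx : IsClosed ({x} : Set X)) (hord : idealOrder J x = μ)
    (hdim : (maximalIdeal (X.presheaf.stalk x)).spanFinrank = 3) {π : X' ⟶ X}
    (hπ : IsBlowup π (vanishingIdeal ⟨{x}, hx⟩))
    {𝒞 : Set (Closeds X)} (h𝒞 : ∀ C, C ∈ 𝒞 ↔ ∃ ζ ∈ maxPoints {z : X | (μ : ℕ∞) ≤ idealOrder J z},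
      ¬ IsClosed ({ζ} : Set X) ∧ C = ⟨closure {ζ}, isClosed_closure⟩)
    {𝒞' : Set (Closeds X')} (h𝒞' : ∀ C', C' ∈ 𝒞' ↔
      ∃ ζ ∈ maxPoints {z : X' | (μ : ℕ∞) ≤ idealOrder (controlledTransform π (vanishingIdeal ⟨{x}, hx⟩) J μ) z},
        ¬ IsClosed ({ζ} : Set X') ∧ C' = ⟨closure {ζ}, isClosed_closure⟩)
    (C' : Closeds X') (hC' : C' ∈ 𝒞') :
    (∃ C ∈ 𝒞, (C' : Set X') = closure (π ⁻¹' ((C : Set X) \ {x}))) ∨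
      (Scheme.IsRegular (vanishingIdeal C').subscheme ∧
        ∀ D ∈ 𝒞', D ≠ C' →
          (¬ ∃ C ∈ 𝒞, (D : Set X') = closure (π ⁻¹' ((C : Set X) \ {x})) ∧
              x ∈ (vanishingIdeal C).subschemeι '' (Scheme.regularLocus (vanishingIdeal C).subscheme)ᶜ) →
          ∀ q ∈ (C' : Set X') ∩ (D : Set X'),
            stalkIdeal (vanishingIdeal C') q ⊔ stalkIdeal (vanishingIdeal D) q = maximalIdeal (X'.presheaf.stalk q)) := by
  have hsuppx : ((vanishingIdeal (⟨{x}, hx⟩ : Closeds X)).support : Set X) = {x} :=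
    Scheme.IdealSheafData.coe_support_vanishingIdeal _
  have hcoh3 : ∀ z : X, Order.coheight z ≤ 3 := (topologicalKrullDim_le_iff_forall_coheight_le X 3).mp hX3
  obtain ⟨η', hη'max, hη'cl, rfl⟩ := (h𝒞' C').mp hC'
  -- case (a) of `pointStep_curves'` read as «strict transform of a member of `𝒞`»
  have caseA : ∀ {ζ : X'}, ¬ IsClosed ({ζ} : Set X') → π ζ ≠ x →
      π ζ ∈ maxPoints {z : X | (μ : ℕ∞) ≤ idealOrder J z} →
      closure ({ζ} : Set X') = closure (π ⁻¹' (closure {π ζ} \ {x})) →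
      ∃ C ∈ 𝒞, closure ({ζ} : Set X') = closure (π ⁻¹' ((C : Set X) \ {x})) := by
    intro ζ hζcl hne hmax hcl
    have hsupp : π ζ ∉ ((vanishingIdeal (⟨{x}, hx⟩ : Closeds X)).support : Set X) := by
      rw [hsuppx]; exact hne
    exact ⟨⟨closure {π ζ}, isClosed_closure⟩,
      (h𝒞 _).mpr ⟨π ζ, hmax, not_isClosed_singleton_apply hπ hζcl hsupp, rfl⟩, hcl⟩
  rcases pointStep_curves' hX hX3 J hμ hle hcodim hx hord hdim hπ hη'max hη'cl with
    ⟨hne, hmax, hcl⟩ | ⟨hηx, hreg, -, huniq⟩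
  · exact Or.inl (caseA hη'cl hne hmax hcl)
  · refine Or.inr ⟨hreg, fun D hD hDne hnotex q hq => ?_⟩
    obtain ⟨hqC', hqD⟩ := hq
    obtain ⟨η'', hη''max, hη''cl, rfl⟩ := (h𝒞' D).mp hD
    -- `C' = cl{η'}` lies in the fibre of `x`
    have hC'fib : closure ({η'} : Set X') ⊆ π ⁻¹' {x} :=
      closure_minimal (Set.singleton_subset_iff.mpr (show π η' ∈ ({x} : Set X) from hηx ▸ rfl))
        (hx.preimage π.continuous)
    have hqx : π q = x := hC'fib hqC'
    rcases pointStep_curves' hX hX3 J hμ hle hcodim hx hord hdim hπ hη''max hη''cl with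
      ⟨hne'', hmax'', hcl''⟩ | ⟨hη''x, -, -, -⟩
    · -- `D` is the strict transform of the curve `C₀ = cl{π η''}`, which is regular at `x`
      obtain ⟨C₀, hC₀, hDC₀⟩ := caseA hη''cl hne'' hmax'' hcl''
      have hxreg : x ∉ (vanishingIdeal C₀).subschemeι '' (Scheme.regularLocus (vanishingIdeal C₀).subscheme)ᶜ :=
        fun h => hnotex ⟨C₀, hC₀, hDC₀, h⟩
      obtain ⟨ζ₀, hζ₀max, hζ₀cl, rfl⟩ := (h𝒞 C₀).mp hC₀
      have hqD' : q ∈ closure (π ⁻¹' (closure {ζ₀} \ {x})) := hDC₀ ▸ hqD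
      by_cases hxC₀ : x ∈ closure ({ζ₀} : Set X)
      · haveI : IsRegularLocalRing (X.presheaf.stalk x) := hX x
        have hζ₀x : ζ₀ ⤳ x := specializes_iff_mem_closure.mpr hxC₀
        have hxζ₀ : ¬ x ⤳ ζ₀ := fun h => by
          have hmem : ζ₀ ∈ ({x} : Set X) := h.mem_closed hx (Set.mem_singleton x)
          rw [Set.mem_singleton_iff] at hmem
          exact hζ₀cl (hmem ▸ hx)
        have hζ₀ord : (μ : ℕ∞) ≤ idealOrder J ζ₀ := by simpa only [Set.mem_setOf_eq] using maxPoints_subset _ hζ₀max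
        have hζ₀supp : ζ₀ ∈ J.support := by
          rw [← one_le_idealOrder_iff]
          exact le_trans (show (1 : ℕ∞) ≤ (μ : ℕ∞) by exact_mod_cast hμ) hζ₀ord
        obtain ⟨c, hc, hcspan⟩ := exists_rsopPair_of_isRegularLocalRing_quotient hζ₀x hxζ₀ (hcodim _ hζ₀supp) (hcoh3 x)
          ((not_mem_image_compl_regularLocus_iff _ hxC₀).mp hxreg)
        -- the local transversality of the strict transform to the exceptional divisor at `q`
        have hCY : ¬ (((⟨closure {ζ₀}, isClosed_closure⟩ : Closeds X) : Set X) ⊆ ((⟨{x}, hx⟩ : Closeds X) : Set X)) := by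
          intro h
          have hmem : ζ₀ ∈ ({x} : Set X) := h (subset_closure (Set.mem_singleton ζ₀))
          rw [Set.mem_singleton_iff] at hmem
          exact hζ₀cl (hmem ▸ hx)
        have hqst : q ∈ closure (π ⁻¹' ((((⟨closure {ζ₀}, isClosed_closure⟩ : Closeds X) : Set X)) \
            ((⟨{x}, hx⟩ : Closeds X) : Set X))) := hqD'
        have hdim3 : ringKrullDim (X.presheaf.stalk x) = 3 := by
          rw [← IsRegularLocalRing.spanFinrank_maximalIdeal, hdim]; rfl
        obtain ⟨-, htrE⟩ := exists_isRsopPart_strictTransform_of_transverseAt hX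
          (isRegular_subscheme_vanishingIdeal_singleton hx) hπ isIrreducible_singleton.closure hCY hqst
          (by rw [hqx]; exact ⟨c, hc, hcspan⟩)
          (fun _ => by
            rw [hqx, stalkIdeal_vanishingIdeal_singleton hx]
            exact sup_eq_right.mpr (stalkIdeal_vanishingIdeal_le_maximalIdeal _ hxC₀))
          (fun _ => by rw [hqx, hdim3])
        have hE := htrE (show π q ∈ (((⟨{x}, hx⟩ : Closeds X)) : Set X) by rw [hqx]; exact Set.mem_singleton x)
        -- `𝓘_Y 𝒪_{X'} ≤ 𝓘_{C'}` since `C' ⊆ π⁻¹(x)`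
        have hleC' : stalkIdeal ((vanishingIdeal (⟨{x}, hx⟩ : Closeds X)).comap π) q ≤
            stalkIdeal (vanishingIdeal (⟨closure {η'}, isClosed_closure⟩ : Closeds X')) q := by
          apply stalkIdeal_mono
          rw [← le_support_iff_le_vanishingIdeal]
          refine SetLike.coe_subset_coe.mp ?_
          rw [support_comap]
          intro z hz
          change π z ∈ ((vanishingIdeal (⟨{x}, hx⟩ : Closeds X)).support : Set X)
          rw [hsuppx]
          exact hC'fib hz
        have hDeq : (⟨closure {η''}, isClosed_closure⟩ : Closeds X') =
            ⟨closure (π ⁻¹' ((((⟨closure {ζ₀}, isClosed_closure⟩ : Closeds X) : Set X)) \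
              ((⟨{x}, hx⟩ : Closeds X) : Set X))), isClosed_closure⟩ := Closeds.ext hDC₀
        rw [hDeq]
        apply le_antisymm
        · exact sup_le (stalkIdeal_vanishingIdeal_le_maximalIdeal _ hqC') (stalkIdeal_vanishingIdeal_le_maximalIdeal _ hqst)
        · calc maximalIdeal (X'.presheaf.stalk q) = _ := hE.symm
            _ ≤ _ := sup_le le_sup_right (hleC'.trans le_sup_left)
      · -- `x ∉ C₀`: the strict transform misses the fibre of `x`
        exfalso
        have hmem : π q ∈ closure ({ζ₀} : Set X) :=
          closure_minimal (Set.preimage_mono Set.sdiff_subset) (isClosed_closure.preimage π.continuous) hqD'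
        rw [hqx] at hmem
        exact hxC₀ hmem
    · -- both curves are lines over `x`: equal or disjoint
      rcases huniq η'' hη''max hη''cl hη''x with heq | hdisj
      · exact absurd (by rw [heq]) hDne
      · exact absurd hdisj (Set.not_disjoint_iff.mpr ⟨q, hqC', hqD⟩)

/-! ## §3 The curves of `Σ` at an admissible stage; bad points -/

/-- **A bad point is a closed point of order `μ` with a three-dimensional local ring**: a singular point of a curve of `Σ`, or a
point where two distinct curves of `Σ` meet, is a closed point (`codim 3`) of `Σ`. [cite: CossartPiltant2008, Prop. 4.4 (proof, p. 10)] -/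
theorem isClosed_of_bad {X : Scheme.{u}} [IsLocallyNoetherian X] (hX : Scheme.IsRegular X) (hX3 : topologicalKrullDim X ≤ 3)
    (J : X.IdealSheafData) {μ : ℕ} (hμ : 1 ≤ μ) (hle : ∀ z, idealOrder J z ≤ μ) (hcodim : ∀ z ∈ J.support, 1 < Order.coheight z)
    {𝒞 : Set (Closeds X)} (h𝒞 : ∀ C, C ∈ 𝒞 ↔ ∃ ζ ∈ maxPoints {z : X | (μ : ℕ∞) ≤ idealOrder J z},
      ¬ IsClosed ({ζ} : Set X) ∧ C = ⟨closure {ζ}, isClosed_closure⟩)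
    {x : X} {C : Closeds X} (hC : C ∈ 𝒞)
    (hbad : x ∈ (vanishingIdeal C).subschemeι '' (Scheme.regularLocus (vanishingIdeal C).subscheme)ᶜ ∨
      (x ∈ (C : Set X) ∧ ∃ C' ∈ 𝒞, C' ≠ C ∧ x ∈ (C' : Set X) ∧
        stalkIdeal (vanishingIdeal C) x ⊔ stalkIdeal (vanishingIdeal C') x ≠ maximalIdeal (X.presheaf.stalk x))) :
    IsClosed ({x} : Set X) ∧ idealOrder J x = μ ∧ (maximalIdeal (X.presheaf.stalk x)).spanFinrank = 3 := by
  have hcoh3 : ∀ z : X, Order.coheight z ≤ 3 := (topologicalKrullDim_le_iff_forall_coheight_le X 3).mp hX3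
  obtain ⟨ζ, hζmax, hζcl, rfl⟩ := (h𝒞 C).mp hC
  have hζord : (μ : ℕ∞) ≤ idealOrder J ζ := by simpa only [Set.mem_setOf_eq] using maxPoints_subset _ hζmax
  have hζsupp : ζ ∈ J.support := by
    rw [← one_le_idealOrder_iff]
    exact le_trans (show (1 : ℕ∞) ≤ (μ : ℕ∞) by exact_mod_cast hμ) hζord
  have hcohζ : Order.coheight ζ = 2 := coheight_eq_two_of_not_isClosed hcoh3 (hcodim _ hζsupp) hζcl
  -- `x ∈ cl{ζ}` and `x ≠ ζ`
  have hxC : x ∈ closure ({ζ} : Set X) ∧ x ≠ ζ := by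
    rcases hbad with ⟨v, hv, hvx⟩ | ⟨hxC, C', hC', hne, hxC', -⟩
    · refine ⟨?_, ?_⟩
      · have h : x ∈ Set.range (vanishingIdeal (⟨closure {ζ}, isClosed_closure⟩ : Closeds X)).subschemeι := ⟨v, hvx⟩
        rw [ComponentGluing.range_subschemeι_vanishingIdeal] at h
        exact h
      · rintro rfl
        exact not_mem_image_compl_regularLocus_self _ ⟨v, hv, hvx⟩
    · refine ⟨hxC, ?_⟩
      rintro rfl
      obtain ⟨ζ', hζ'max, -, rfl⟩ := (h𝒞 C').mp hC'
      have hsp : ζ' ⤳ x := specializes_iff_mem_closure.mpr hxC'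
      have hζ'ord : (μ : ℕ∞) ≤ idealOrder J ζ' := by simpa only [Set.mem_setOf_eq] using maxPoints_subset _ hζ'max
      have heq : ζ' = x := (mem_maxPoints_iff.mp hζmax).2 ζ' hζ'ord hsp
      exact hne (by rw [heq])
  obtain ⟨h3, hcl⟩ := isClosed_singleton_of_mem_closure_of_ne hcoh3 hcohζ hxC.1 hxC.2
  haveI : IsRegularLocalRing (X.presheaf.stalk x) := hX x
  refine ⟨hcl, le_antisymm (hle x) ?_, spanFinrank_maximalIdeal_stalk_eq x h3⟩
  exact hζord.trans (idealOrder_le_of_specializes (specializes_iff_mem_closure.mpr hxC.1) J)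

/-! ## §4 Phase I: reaching a stage with regular, pairwise transverse curves -/

/-- **Phase I of the algorithm (steps 1–2 terminate).** From an integral Noetherian regular quasi-excellent `X` of dimension `≤ 3`
with `(J, μ)`, `μ ≥ 1`, `ord ≤ μ`, `codim V(J) ≥ 2`, a W4.6 sequence of permissible blowing-ups (at closed points) reaches a stage
`(X₁, J₁)` with NO bad point: no curve of `Σ₁ = {ord J₁ ≥ μ}` has a singular point and any two distinct curves of `Σ₁` meet
transversally at every common point. [cite: CossartPiltant2008, Prop. 4.4 (proof, p. 10, steps 1–2)] -/
theorem exists_seq_regular_transverse {X : Scheme.{u}} [IsIntegral X] [IsNoetherian X] (hX : Scheme.IsRegular X)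
    (hqe : Scheme.IsQuasiExcellent X) (hX3 : topologicalKrullDim X ≤ 3) (J : X.IdealSheafData) {μ : ℕ} (hμ : 1 ≤ μ)
    (hle : ∀ z, idealOrder J z ≤ μ) (hcodim : ∀ z ∈ J.support, 1 < Order.coheight z) :
    ∃ (X₁ : Scheme.{u}) (Φ : X₁ ⟶ X) (J₁ : X₁.IdealSheafData) (_ : CampaignW46.IsPermissibleBlowupSeq J μ Φ J₁),
      ∀ x : X₁, ¬ ∃ C ∈ {C : Closeds X₁ | ∃ ζ ∈ maxPoints {z : X₁ | (μ : ℕ∞) ≤ idealOrder J₁ z},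
          ¬ IsClosed ({ζ} : Set X₁) ∧ C = ⟨closure {ζ}, isClosed_closure⟩},
        x ∈ (vanishingIdeal C).subschemeι '' (Scheme.regularLocus (vanishingIdeal C).subscheme)ᶜ ∨
        (x ∈ (C : Set X₁) ∧ ∃ C' ∈ {C : Closeds X₁ | ∃ ζ ∈ maxPoints {z : X₁ | (μ : ℕ∞) ≤ idealOrder J₁ z},
            ¬ IsClosed ({ζ} : Set X₁) ∧ C = ⟨closure {ζ}, isClosed_closure⟩}, C' ≠ C ∧ x ∈ (C' : Set X₁) ∧
          stalkIdeal (vanishingIdeal C) x ⊔ stalkIdeal (vanishingIdeal C') x ≠ maximalIdeal (X₁.presheaf.stalk x)) := by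
  classical
  by_contra Hc
  -- every reachable stage has a bad point; blow it up
  have inv := fun {X₁ : Scheme.{u}} {Φ : X₁ ⟶ X} {J₁ : X₁.IdealSheafData}
      (h : CampaignW46.IsPermissibleBlowupSeq J μ Φ J₁) => IsPermissibleBlowupSeq.prop44Invariants hX hqe hμ hle hcodim h
  -- the property recorded at each step: the centre is a bad point
  let P : ∀ (X₁ : Scheme.{u}), X₁.IdealSheafData → Closeds X₁ → Prop := fun X₁ J₁ D =>
    ∃ (x : X₁) (hx : IsClosed ({x} : Set X₁)), D = ⟨{x}, hx⟩ ∧ idealOrder J₁ x = μ ∧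
      (maximalIdeal (X₁.presheaf.stalk x)).spanFinrank = 3 ∧
      ∃ C ∈ {C : Closeds X₁ | ∃ ζ ∈ maxPoints {z : X₁ | (μ : ℕ∞) ≤ idealOrder J₁ z},
          ¬ IsClosed ({ζ} : Set X₁) ∧ C = ⟨closure {ζ}, isClosed_closure⟩},
        x ∈ (vanishingIdeal C).subschemeι '' (Scheme.regularLocus (vanishingIdeal C).subscheme)ᶜ ∨
        (x ∈ (C : Set X₁) ∧ ∃ C' ∈ {C : Closeds X₁ | ∃ ζ ∈ maxPoints {z : X₁ | (μ : ℕ∞) ≤ idealOrder J₁ z},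
            ¬ IsClosed ({ζ} : Set X₁) ∧ C = ⟨closure {ζ}, isClosed_closure⟩}, C' ≠ C ∧ x ∈ (C' : Set X₁) ∧
          stalkIdeal (vanishingIdeal C) x ⊔ stalkIdeal (vanishingIdeal C') x ≠ maximalIdeal (X₁.presheaf.stalk x))
  have H : ∀ (X₁ : Scheme.{u}) (Φ : X₁ ⟶ X) (J₁ : X₁.IdealSheafData), CampaignW46.IsPermissibleBlowupSeq J μ Φ J₁ →
      ∃ (X₂ : Scheme.{u}) (π : X₂ ⟶ X₁) (D : Closeds X₁),
        IsBlowup π (vanishingIdeal D) ∧ Scheme.IsRegular (vanishingIdeal D).subscheme ∧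
        (∀ y ∈ (D : Set X₁), (μ : ℕ∞) ≤ idealOrder J₁ y) ∧ P X₁ J₁ D := by
    intro X₁ Φ J₁ hseq
    obtain ⟨hint₁, hnoeth₁, hX₁, hqe₁, hle₁, hcodim₁⟩ := inv hseq
    haveI := hint₁
    haveI := hnoeth₁
    have hX3₁ : topologicalKrullDim X₁ ≤ 3 := hseq.topologicalKrullDim_le inferInstance hX3
    -- a bad point exists at this stage
    have hbad : ∃ x : X₁, ∃ C ∈ {C : Closeds X₁ | ∃ ζ ∈ maxPoints {z : X₁ | (μ : ℕ∞) ≤ idealOrder J₁ z},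
          ¬ IsClosed ({ζ} : Set X₁) ∧ C = ⟨closure {ζ}, isClosed_closure⟩},
        x ∈ (vanishingIdeal C).subschemeι '' (Scheme.regularLocus (vanishingIdeal C).subscheme)ᶜ ∨
        (x ∈ (C : Set X₁) ∧ ∃ C' ∈ {C : Closeds X₁ | ∃ ζ ∈ maxPoints {z : X₁ | (μ : ℕ∞) ≤ idealOrder J₁ z},
            ¬ IsClosed ({ζ} : Set X₁) ∧ C = ⟨closure {ζ}, isClosed_closure⟩}, C' ≠ C ∧ x ∈ (C' : Set X₁) ∧
          stalkIdeal (vanishingIdeal C) x ⊔ stalkIdeal (vanishingIdeal C') x ≠ maximalIdeal (X₁.presheaf.stalk x)) := by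
      by_contra h
      exact Hc ⟨X₁, Φ, J₁, hseq, fun x hx => h ⟨x, hx⟩⟩
    obtain ⟨x, C, hC, hxbad⟩ := hbad
    obtain ⟨hxcl, hordx, hdimx⟩ := isClosed_of_bad hX₁ hX3₁ J₁ hμ hle₁ hcodim₁ (𝒞 := {C : Closeds X₁ | _})
      (fun C => Iff.rfl) hC hxbad
    obtain ⟨X₂, π, hπ⟩ := exists_isBlowup X₁ (vanishingIdeal (⟨{x}, hxcl⟩ : Closeds X₁))
    refine ⟨X₂, π, ⟨{x}, hxcl⟩, hπ, isRegular_subscheme_vanishingIdeal_singleton hxcl, ?_, x, hxcl, rfl, hordx, hdimx,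
      C, hC, hxbad⟩
    rintro y (rfl : y = x)
    exact hordx.ge
  obtain ⟨Xs, π, D, Js, Φ, hπ, hseq, hJ, -, hP⟩ := exists_chain_of_forall_step J P H
  -- read off the bad points
  choose x hx hDx hordx hdimx hbadx using hP
  have hπ' : ∀ n, IsBlowup (π n) (vanishingIdeal ⟨{x n}, hx n⟩) := fun n => hDx n ▸ hπ n
  have hJ' : ∀ n, Js (n + 1) = controlledTransform (π n) (vanishingIdeal ⟨{x n}, hx n⟩) (Js n) μ := fun n => hDx n ▸ hJ n
  -- stage invariants
  have hint : ∀ n, IsIntegral (Xs n) := fun n => (inv (hseq n)).1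
  have hnoeth : ∀ n, IsNoetherian (Xs n) := fun n => (inv (hseq n)).2.1
  haveI : ∀ n, IsLocallyNoetherian (Xs n) := fun n => inferInstance
  have hreg : ∀ n, Scheme.IsRegular (Xs n) := fun n => (inv (hseq n)).2.2.1
  have hqe' : ∀ n, Scheme.IsQuasiExcellent (Xs n) := fun n => (inv (hseq n)).2.2.2.1
  have hle' : ∀ n, ∀ z, idealOrder (Js n) z ≤ μ := fun n => (inv (hseq n)).2.2.2.2.1
  have hcodim' : ∀ n, ∀ z ∈ (Js n).support, 1 < Order.coheight z := fun n => (inv (hseq n)).2.2.2.2.2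
  have hX3' : ∀ n, topologicalKrullDim (Xs n) ≤ 3 := fun n => (hseq n).topologicalKrullDim_le inferInstance hX3
  have hcoh3 : ∀ n, ∀ z : Xs n, Order.coheight z ≤ 3 := fun n =>
    (topologicalKrullDim_le_iff_forall_coheight_le (Xs n) 3).mp (hX3' n)
  -- the configurations of curves
  let 𝒞 : ∀ n, Set (Closeds (Xs n)) := fun n => {C : Closeds (Xs n) | ∃ ζ ∈ maxPoints {z : Xs n | (μ : ℕ∞) ≤ idealOrder (Js n) z},
    ¬ IsClosed ({ζ} : Set (Xs n)) ∧ C = ⟨closure {ζ}, isClosed_closure⟩}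
  have hmaxord : ∀ n, ∀ ζ ∈ maxPoints {z : Xs n | (μ : ℕ∞) ≤ idealOrder (Js n) z}, (μ : ℕ∞) ≤ idealOrder (Js n) ζ :=
    fun n ζ hζ => by simpa only [Set.mem_setOf_eq] using maxPoints_subset _ hζ
  have hsupp : ∀ n, ∀ ζ ∈ maxPoints {z : Xs n | (μ : ℕ∞) ≤ idealOrder (Js n) z}, ζ ∈ (Js n).support := fun n ζ hζ => by
    rw [← one_le_idealOrder_iff]
    exact le_trans (show (1 : ℕ∞) ≤ (μ : ℕ∞) by exact_mod_cast hμ) (hmaxord n ζ hζ)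
  refine false_of_badPointChain_of_curveConfiguration Xs π x hx hπ' 𝒞 (fun n => ?_) (fun n C hC => ?_) (fun n C hC => ?_)
    (fun n C hC => ?_) (fun n C hC => ?_) (fun n C hC C₂ hC₂ hsub => ?_) (fun n => hbadx n)
    (fun n C₁ hC₁ => ?_)
  · -- finitely many curves
    have hJne : Js n ≠ ⊥ := ne_bot_of_forall_one_lt_coheight (hcodim' n)
    have hcl : IsClosed {z : Xs n | (μ : ℕ∞) ≤ idealOrder (Js n) z} :=
      isClosed_setOf_le_idealOrder_of_isJ2 (hreg n) (fun U => ((hqe' n) U).isJ2Ring) hJne μ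
    refine ((maxPoints_finite hcl).image fun ζ => (⟨closure {ζ}, isClosed_closure⟩ : Closeds (Xs n))).subset ?_
    rintro C ⟨ζ, hζ, -, rfl⟩
    exact ⟨ζ, hζ, rfl⟩
  · obtain ⟨ζ, -, -, rfl⟩ := hC
    exact isIntegral_subscheme_closure ζ
  · obtain ⟨ζ, -, -, rfl⟩ := hC
    exact isNoetherian_subscheme_closure ζ
  · obtain ⟨ζ, -, -, rfl⟩ := hC
    exact isQuasiExcellent_subscheme_closure (hqe' n) ζ
  · obtain ⟨ζ, hζ, hζcl, rfl⟩ := hC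
    exact topologicalKrullDim_subscheme_closure_eq_one (hX3' n)
      (coheight_eq_two_of_not_isClosed (hcoh3 n) (hcodim' n _ (hsupp n ζ hζ)) hζcl) hζcl
  · -- pairwise incomparable
    obtain ⟨ζ, hζ, -, rfl⟩ := hC
    obtain ⟨ζ₂, hζ₂, -, rfl⟩ := hC₂
    have hmem : ζ ∈ closure ({ζ₂} : Set (Xs n)) := hsub (subset_closure (Set.mem_singleton ζ))
    have heq : ζ₂ = ζ := (mem_maxPoints_iff.mp hζ).2 ζ₂ (hmaxord n ζ₂ hζ₂) (specializes_iff_mem_closure.mpr hmem)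
    rw [heq]
  · -- the successor rule
    exact pointStep_next (hreg n) (hX3' n) (Js n) hμ (hle' n) (hcodim' n) (hx n) (hordx n) (hdimx n) (hπ' n)
      (𝒞 := 𝒞 n) (fun C => Iff.rfl) (𝒞' := 𝒞 (n + 1)) (fun C' => by rw [← hJ' n]; rfl) C₁ hC₁

end CP2008Prop44

end Summit.ResolutionOfSingularities.ResolutionOfSingularities.Theorems

end
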